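import Mathlib
import Summits.ValiantsHypothesis.ValiantsHypothesis.Theorems.NewtonUnitEquationsNewtonTauWeakCornerWords
import Summits.ValiantsHypothesis.ValiantsHypothesis.Theorems.NewtonUnitEquationsNewtonTauWeakK3Defs
import Summits.ValiantsHypothesis.ValiantsHypothesis.Theorems.NewtonUnitEquationsNewtonTauWeakStubChartPairCount
import Summits.ValiantsHypothesis.ValiantsHypothesis.Theorems.NewtonUnitEquationsNewtonTauWeakHexagonPlanar

/-!
# `NewtonTauWeak` (stmt-ValiantsHypothesis-5904), stub `fixedKCoincidence_t2_K3`: counting the candidates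

Helper file of the proof of the `K = 3` sub-stub `fixedKCoincidence_t2_K3` of `stub_binomialNewtonTauCommon`
(line `binomial-normal-form`; siege variation "polynomial identity route").  Planar counting for the final
assembly: at most two tops of a bivariate polynomial on a lattice line (`ncard_tops_on_line_le_two`, after lead c3's
`hex_ncard_extremePoints_inter_line_le_two`); the flipped-line patterns `{e | 0 < σ q_{e,0} + t q_{e,1}}` along a
chart `t ↦ (σ, t)` form a CHAIN, hence number at most `s + 1` (`card_patterns_le`); and for a fixed pattern `SL`
the three candidate families of `tops_trichotomy` (corners; corners + a line of the list, met by tops at most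
twice; corners + two order points) contain at most `3 + 6 s + 243 s²` tops (`ncard_candidates_le`).
No definitions. [this line; new]
-/

set_option linter.dupNamespace false

noncomputable section

open scoped BigOperators Polynomial

namespace Summit.ValiantsHypothesis.ValiantsHypothesis.Theorems.NewtonUnitEquationsNewtonTauWeak

open Summit.ValiantsHypothesis.ValiantsHypothesis.Theorems.NewtonTauWeakCorner
open Summit.ValiantsHypothesis.ValiantsHypothesis.Theorems.NewtonTauWeakK3
open Summit.ValiantsHypothesis.ValiantsHypothesis.Theorems.NewtonTauWeakVdp (wdeg IsGeneric IsTop)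

namespace K3Pi

/-! ## At most two tops on a lattice line -/

/-- At most two tops of `f` (over all weights) lie on a line `a e₀ + b e₁ = cc` (`(a, b) ≠ 0`). [folklore;
c3's `hex_ncard_extremePoints_inter_line_le_two`] -/
theorem ncard_tops_on_line_le_two (f : MvPolynomial (Fin 2) ℂ) (a b cc : ℤ) (hab : a ≠ 0 ∨ b ≠ 0) :
    {v : Fin 2 →₀ ℕ | (∃ w : Fin 2 → ℝ, IsTop w f v) ∧ a * (v 0 : ℤ) + b * (v 1 : ℤ) = cc}.ncard ≤ 2 := by
  have hfin : (Set.extremePoints ℝ (convexHull ℝ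
      ((fun e : Fin 2 →₀ ℕ => fun i : Fin 2 => ((e i : ℕ) : ℝ)) '' (f.support : Set (Fin 2 →₀ ℕ)))) ∩
        {p | (a : ℝ) * p 0 + (b : ℝ) * p 1 = (cc : ℝ)}).Finite :=
    ((f.support.finite_toSet.image _).subset extremePoints_convexHull_subset).subset Set.inter_subset_left
  have hab' : (a : ℝ) ≠ 0 ∨ (b : ℝ) ≠ 0 := by
    rcases hab with h | h
    · exact Or.inl (by exact_mod_cast h)
    · exact Or.inr (by exact_mod_cast h)
  refine (Set.ncard_le_ncard_of_injOn (fun e : Fin 2 →₀ ℕ => fun i : Fin 2 => ((e i : ℕ) : ℝ)) ?_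
    ChartPairCount.emb_injective.injOn hfin).trans
    (hex_ncard_extremePoints_inter_line_le_two _ (a : ℝ) (b : ℝ) (cc : ℝ) hab')
  rintro v ⟨⟨w, hw⟩, hv⟩
  refine ⟨ChartPairCount.emb_mem_extremePoints_of_isTop hw, ?_⟩
  have hv' : ((a : ℤ) : ℝ) * (((v 0 : ℕ) : ℤ) : ℝ) + ((b : ℤ) : ℝ) * (((v 1 : ℕ) : ℤ) : ℝ) = ((cc : ℤ) : ℝ) := by
    exact_mod_cast congrArg (Int.cast : ℤ → ℝ) hv
  show (a : ℝ) * ((v 0 : ℕ) : ℝ) + (b : ℝ) * ((v 1 : ℕ) : ℝ) = (cc : ℝ)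
  push_cast at hv'
  exact hv'

/-- Tops on the lattice line through `P` with direction `Ez ≠ 0` are at most two. [folklore] -/
theorem ncard_tops_on_ray_line_le_two (f : MvPolynomial (Fin 2) ℂ) (P Ez : Fin 2 → ℤ) (hE : Ez ≠ 0) :
    {v : Fin 2 →₀ ℕ | (∃ w : Fin 2 → ℝ, IsTop w f v) ∧ ∃ k : ℤ, expZ v = P + k • Ez}.ncard ≤ 2 := by
  have hab : Ez 1 ≠ 0 ∨ -Ez 0 ≠ 0 := by
    by_contra h
    push Not at h
    apply hE; funext i; fin_cases i
    · simpa using h.2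
    · exact h.1
  refine le_trans (Set.ncard_le_ncard ?_ ?_) (ncard_tops_on_line_le_two f (Ez 1) (-Ez 0) (Ez 1 * P 0 - Ez 0 * P 1) hab)
  · rintro v ⟨hw, k, hk⟩
    refine ⟨hw, ?_⟩
    have h0 := congr_fun hk 0
    have h1 := congr_fun hk 1
    simp only [expZ_apply, Pi.add_apply, Pi.smul_apply, smul_eq_mul] at h0 h1
    rw [h0, h1]; ring
  · exact (ChartPairCount.tops_finite f).subset fun v hv => hv.1

/-! ## The chain of flip patterns along a chart -/

/-- **Flip patterns along a chart form a chain**, so there are at most `s + 1` of them. [folklore] -/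
theorem card_patterns_le {s : ℕ} (q : Fin s → Fin 2 →₀ ℕ) (σ : ℝ) (R : Finset (Finset (Fin s)))
    (hR : ∀ SL ∈ R, ∃ t : ℝ, SL = Finset.univ.filter fun e => 0 < wdeg ![σ, t] (q e)) : R.card ≤ s + 1 := by
  classical
  -- monotonicity in `t`
  have hmono : ∀ t t' : ℝ, t ≤ t' →
      (Finset.univ.filter fun e => 0 < wdeg ![σ, t] (q e)) ⊆ Finset.univ.filter fun e => 0 < wdeg ![σ, t'] (q e) := by
    intro t t' htt e he
    rw [Finset.mem_filter] at he ⊢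
    refine ⟨he.1, lt_of_lt_of_le he.2 ?_⟩
    rw [ChartPairCount.wdeg_chart, ChartPairCount.wdeg_chart]
    have : (0 : ℝ) ≤ ((q e 1 : ℕ) : ℝ) := Nat.cast_nonneg _
    nlinarith
  -- the cardinality is injective on `R`
  have hinj : Set.InjOn Finset.card (R : Set (Finset (Fin s))) := by
    intro A hA B hB hcard
    obtain ⟨t, rfl⟩ := hR A hA
    obtain ⟨t', rfl⟩ := hR B hB
    rcases le_total t t' with h | h
    · exact Finset.eq_of_subset_of_card_le (hmono t t' h) hcard.ge
    · exact (Finset.eq_of_subset_of_card_le (hmono t' t h) hcard.le).symm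
  calc R.card = (R.image Finset.card).card := (Finset.card_image_of_injOn hinj).symm
    _ ≤ (Finset.range (s + 1)).card := Finset.card_le_card fun n hn => by
        obtain ⟨A, -, rfl⟩ := Finset.mem_image.mp hn
        exact Finset.mem_range.mpr (Nat.lt_succ_of_le ((Finset.card_le_univ A).trans (by simp)))
    _ = s + 1 := Finset.card_range _

/-! ## Counting the candidates of one flip pattern -/

/-- **CANDIDATE COUNT for one flip pattern `SL`.** Among the tops of `f` (over all weights): those equal to a
flipped corner `P_l` are at most `3`; those on a line `P_l + ℤ E_{e₀}` at most `6 s`; those of the form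
`P_l + k₁ E_{e₁} + k₂ E_{e₂}` with `k_i` the (unique) orders of prescribed pairwise differences of line factors at
most `243 s²`. [this line] -/
theorem ncard_candidates_le {N s : ℕ} (f : MvPolynomial (Fin 2) ℂ) (ρ : Fin 3 → Fin N → ℂ)
    (d : Fin N → Fin 2 →₀ ℕ) (q : Fin s → Fin 2 →₀ ℕ) (cl : Fin N → Fin s) (g : Fin N → ℕ) (hq0 : ∀ e, q e ≠ 0)
    (SL : Finset (Fin s)) :
    {v : Fin 2 →₀ ℕ | (∃ w : Fin 2 → ℝ, IsTop w f v) ∧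
      ((∃ l : Fin 3, expZ v = expZ (∑ j ∈ Finset.univ.filter (fun j => d j ≠ 0 ∧ ρ l j ≠ 0 ∧ cl j ∈ SL), d j)) ∨
      (∃ l : Fin 3, ∃ e₀ : Fin s, ∃ k : ℕ,
        expZ v = expZ (∑ j ∈ Finset.univ.filter (fun j => d j ≠ 0 ∧ ρ l j ≠ 0 ∧ cl j ∈ SL), d j) +
          (k : ℤ) • (if e₀ ∈ SL then -expZ (q e₀) else expZ (q e₀))) ∨
      (∃ l : Fin 3, ∃ e₁ e₂ : Fin s, ∃ l₁ l₁' l₂ l₂' : Fin 3, ∃ k₁ k₂ : ℕ,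
        IsOrder ((∏ j ∈ Finset.univ.filter (fun j => d j ≠ 0 ∧ ρ l₁ j ≠ 0 ∧ cl j = e₁),
            (1 + Polynomial.C (if cl j ∈ SL then (-ρ l₁ j)⁻¹ else -ρ l₁ j) * Polynomial.X ^ g j)) -
          ∏ j ∈ Finset.univ.filter (fun j => d j ≠ 0 ∧ ρ l₁' j ≠ 0 ∧ cl j = e₁),
            (1 + Polynomial.C (if cl j ∈ SL then (-ρ l₁' j)⁻¹ else -ρ l₁' j) * Polynomial.X ^ g j)) k₁ ∧
        IsOrder ((∏ j ∈ Finset.univ.filter (fun j => d j ≠ 0 ∧ ρ l₂ j ≠ 0 ∧ cl j = e₂),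
            (1 + Polynomial.C (if cl j ∈ SL then (-ρ l₂ j)⁻¹ else -ρ l₂ j) * Polynomial.X ^ g j)) -
          ∏ j ∈ Finset.univ.filter (fun j => d j ≠ 0 ∧ ρ l₂' j ≠ 0 ∧ cl j = e₂),
            (1 + Polynomial.C (if cl j ∈ SL then (-ρ l₂' j)⁻¹ else -ρ l₂' j) * Polynomial.X ^ g j)) k₂ ∧
        expZ v = expZ (∑ j ∈ Finset.univ.filter (fun j => d j ≠ 0 ∧ ρ l j ≠ 0 ∧ cl j ∈ SL), d j) +
          ((k₁ : ℤ) • (if e₁ ∈ SL then -expZ (q e₁) else expZ (q e₁)) +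
            (k₂ : ℤ) • (if e₂ ∈ SL then -expZ (q e₂) else expZ (q e₂)))))}.ncard ≤ 3 + 6 * s + 243 * s ^ 2 := by
  classical
  set E : Fin s → Fin 2 → ℤ := fun e => if e ∈ SL then -expZ (q e) else expZ (q e) with hEdef
  set U : Fin 3 → Fin s → ℂ[X] := fun l e => ∏ j ∈ Finset.univ.filter (fun j => d j ≠ 0 ∧ ρ l j ≠ 0 ∧ cl j = e),
      (1 + Polynomial.C (if cl j ∈ SL then (-ρ l j)⁻¹ else -ρ l j) * Polynomial.X ^ g j) with hUdef
  set Pz : Fin 3 → Fin 2 → ℤ := fun l =>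
    expZ (∑ j ∈ Finset.univ.filter (fun j => d j ≠ 0 ∧ ρ l j ≠ 0 ∧ cl j ∈ SL), d j) with hPzdef
  set Tall : Set (Fin 2 →₀ ℕ) := {v | ∃ w : Fin 2 → ℝ, IsTop w f v} with hTall
  have hTfin : Tall.Finite := ChartPairCount.tops_finite f
  -- the three families
  set C0 : Set (Fin 2 →₀ ℕ) := {v | ∃ l : Fin 3, expZ v = Pz l} with hC0
  set C1 : Set (Fin 2 →₀ ℕ) := {v | v ∈ Tall ∧ ∃ l : Fin 3, ∃ e₀ : Fin s, ∃ k : ℕ, expZ v = Pz l + (k : ℤ) • E e₀}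
    with hC1
  set C2 : Set (Fin 2 →₀ ℕ) := {v | ∃ l : Fin 3, ∃ e₁ e₂ : Fin s, ∃ l₁ l₁' l₂ l₂' : Fin 3, ∃ k₁ k₂ : ℕ,
      IsOrder (U l₁ e₁ - U l₁' e₁) k₁ ∧ IsOrder (U l₂ e₂ - U l₂' e₂) k₂ ∧
        expZ v = Pz l + ((k₁ : ℤ) • E e₁ + (k₂ : ℤ) • E e₂)} with hC2
  -- the set to bound is contained in `C0 ∪ C1 ∪ C2`
  refine le_trans (Set.ncard_le_ncard (t := C0 ∪ C1 ∪ C2) ?_ ?_) ?_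
  · rintro v ⟨hT, h⟩
    rcases h with h | h | h
    · exact Or.inl (Or.inl h)
    · exact Or.inl (Or.inr ⟨hT, h⟩)
    · exact Or.inr h
  · -- finiteness: `C0`, `C2` inject into finite sets, `C1 ⊆ Tall`
    refine Set.Finite.union (Set.Finite.union ?_ (hTfin.subset fun v hv => hv.1)) ?_
    · refine Set.Finite.of_finite_image (f := expZ) ?_ expZ_injective.injOn
      refine (Set.finite_range Pz).subset ?_
      rintro _ ⟨v, ⟨l, hl⟩, rfl⟩; exact ⟨l, hl.symm⟩
    · refine Set.Finite.of_finite_image (f := expZ) ?_ expZ_injective.injOn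
      let Φ : Fin 3 × Fin s × Fin s × Fin 3 × Fin 3 × Fin 3 × Fin 3 → Fin 2 → ℤ := fun x =>
        Pz x.1 + (((if h : ∃ k, IsOrder (U x.2.2.2.1 x.2.1 - U x.2.2.2.2.1 x.2.1) k then Classical.choose h else 0 : ℕ) : ℤ)
          • E x.2.1 + ((if h : ∃ k, IsOrder (U x.2.2.2.2.2.1 x.2.2.1 - U x.2.2.2.2.2.2 x.2.2.1) k then
            Classical.choose h else 0 : ℕ) : ℤ) • E x.2.2.1)
      refine (Set.finite_range Φ).subset ?_
      rintro _ ⟨v, ⟨l, e₁, e₂, l₁, l₁', l₂, l₂', k₁, k₂, hk₁, hk₂, hv⟩, rfl⟩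
      refine ⟨(l, e₁, e₂, l₁, l₁', l₂, l₂'), ?_⟩
      simp only [Φ]
      rw [hv, dif_pos ⟨k₁, hk₁⟩, dif_pos ⟨k₂, hk₂⟩, (Classical.choose_spec ⟨k₁, hk₁⟩ : IsOrder _ _).unique hk₁,
        (Classical.choose_spec ⟨k₂, hk₂⟩ : IsOrder _ _).unique hk₂]
  -- counting
  have h0 : C0.ncard ≤ 3 := by
    refine (Set.ncard_le_ncard_of_injOn expZ (t := Set.range Pz) ?_ expZ_injective.injOn (Set.finite_range Pz)).trans ?_
    · rintro v ⟨l, hl⟩; exact ⟨l, hl.symm⟩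
    · calc (Set.range Pz).ncard ≤ (Set.univ : Set (Fin 3)).ncard := by
            rw [← Set.image_univ]; exact Set.ncard_image_le Set.finite_univ
        _ = 3 := by rw [Set.ncard_univ]; simp
  have h1 : C1.ncard ≤ 6 * s := by
    have hsub : C1 ⊆ ⋃ p : Fin 3 × Fin s, {v | v ∈ Tall ∧ ∃ k : ℤ, expZ v = Pz p.1 + k • E p.2} := by
      rintro v ⟨hT, l, e₀, k, hk⟩
      exact Set.mem_iUnion.mpr ⟨(l, e₀), hT, (k : ℤ), hk⟩
    refine (Set.ncard_le_ncard hsub ?_).trans ?_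
    · exact hTfin.subset (Set.iUnion_subset fun p v hv => hv.1)
    · refine (Set.ncard_iUnion_le_of_fintype _).trans ?_
      have hE0 : ∀ e, E e ≠ 0 := by
        intro e h
        apply hq0 e
        have h' : expZ (q e) = 0 := by
          simp only [hEdef] at h; split_ifs at h
          · exact neg_eq_zero.mp h
          · exact h
        exact expZ_injective (by rw [h', map_zero])
      calc ∑ p : Fin 3 × Fin s, {v | v ∈ Tall ∧ ∃ k : ℤ, expZ v = Pz p.1 + k • E p.2}.ncard
          ≤ ∑ _p : Fin 3 × Fin s, 2 := Finset.sum_le_sum fun p _ =>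
            ncard_tops_on_ray_line_le_two f (Pz p.1) (E p.2) (hE0 p.2)
        _ = 6 * s := by simp [Finset.sum_const, Finset.card_univ]; ring
  have h2 : C2.ncard ≤ 243 * s ^ 2 := by
    let Φ : Fin 3 × Fin s × Fin s × Fin 3 × Fin 3 × Fin 3 × Fin 3 → Fin 2 → ℤ := fun x =>
      Pz x.1 + (((if h : ∃ k, IsOrder (U x.2.2.2.1 x.2.1 - U x.2.2.2.2.1 x.2.1) k then Classical.choose h else 0 : ℕ) : ℤ)
        • E x.2.1 + ((if h : ∃ k, IsOrder (U x.2.2.2.2.2.1 x.2.2.1 - U x.2.2.2.2.2.2 x.2.2.1) k then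
          Classical.choose h else 0 : ℕ) : ℤ) • E x.2.2.1)
    refine (Set.ncard_le_ncard_of_injOn expZ (t := Set.range Φ) ?_ expZ_injective.injOn (Set.finite_range Φ)).trans ?_
    · rintro v ⟨l, e₁, e₂, l₁, l₁', l₂, l₂', k₁, k₂, hk₁, hk₂, hv⟩
      refine ⟨(l, e₁, e₂, l₁, l₁', l₂, l₂'), ?_⟩
      simp only [Φ]
      rw [hv, dif_pos ⟨k₁, hk₁⟩, dif_pos ⟨k₂, hk₂⟩, (Classical.choose_spec ⟨k₁, hk₁⟩ : IsOrder _ _).unique hk₁,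
        (Classical.choose_spec ⟨k₂, hk₂⟩ : IsOrder _ _).unique hk₂]
    · calc (Set.range Φ).ncard ≤ (Set.univ : Set (Fin 3 × Fin s × Fin s × Fin 3 × Fin 3 × Fin 3 × Fin 3)).ncard := by
            rw [← Set.image_univ]; exact Set.ncard_image_le Set.finite_univ
        _ = 243 * s ^ 2 := by rw [Set.ncard_univ]; simp; ring
  calc (C0 ∪ C1 ∪ C2).ncard ≤ (C0 ∪ C1).ncard + C2.ncard := Set.ncard_union_le _ _
    _ ≤ C0.ncard + C1.ncard + C2.ncard := by have := Set.ncard_union_le C0 C1; omega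
    _ ≤ 3 + 6 * s + 243 * s ^ 2 := by omega

end K3Pi

end Summit.ValiantsHypothesis.ValiantsHypothesis.Theorems.NewtonUnitEquationsNewtonTauWeak

end
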